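import Summits.CriticalPhenomena.SAWScalingLimit.Theorems.SAWLeftRightFKGFKGToTraversalBoundOutlineAbab
import HarnessLib

/-!
# A straight step of the tour moves the obstacle contact index forward (witness unit U5b)

Crux `SAWLeftRightFKG.FKGToTraversalBound` (stmt-CriticalPhenomena-1878), line `slit-necklace`, lead
prover-line-stmt-CriticalPhenomena-1878-c5-0; witness unit U5 (cyclic monotonicity of the contacts of a far piece
along the wall-follower tour), sub-unit U5b, on top of the vocabulary `…SlitNecklaceOutline` (`ODir`, `vec`, `ccw`),
`…OutlineFaces` (`cornerFace`, `sepEdge_cornerFace`) and `…OutlineAbab` (`abab_walkWinding_ne_of_sepEdge_mem`).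

Registered stub `obstacle_step_straight`.  Setting: `A ⊆ ℤ²` finite and `4`-connected (the free component), `r` a
lattice PATH from `u` to `v` avoiding `A` (the obstacle), all of whose contacts with `A` are of LEFT type; escapes to
the far right from `v` and from a boundary edge `{a₀, c₀}` of `A`, avoiding `A` and the interior vertices of `r`.
At a boundary edge `(f, d)` of `A` with contact `r m = f + d` where the tour goes STRAIGHT (`f + ccw d ∈ A`, next
contact `r m' = f + ccw d + d = r m + ccw d`), the contact index increases: `m < m'`.

Proof.  If `m' ≤ m`, the two left-type alternatives at the two contacts and injectivity of `r.getVert` leave only a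
PINCH: `r (m' + 1) = r m' + t`, `r (m - 1) = r m - t` (`t = ccw d`), `m' + 2 ≤ m`, and then `r (m + 1) = r m + d`
(the only free neighbour of `r m`).  Close the sub-path `r m' … r m` of `r` by the lattice edge `{r m, r m + t}`
into a closed lattice TRAIL `Λ` (the POCKET LOOP).  By the jump lemma `Λ` winds differently about the two faces
of that edge (`abab_walkWinding_ne_of_sepEdge_mem`).  But both windings vanish: the face on the `-d` side is a face
around `f ∈ A`, joined inside `A` to `a₀`, then through `c₀` and the escape to the far right, all off `Λ`
(`walkWinding_eq_of_mem_corners`, `walkWinding_eq_of_walk_closed`, `walkWinding_eq_zero_of_right`); the face on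
the `+d` side is a face around `r (m + 1)`, joined by the tail of `r` and the escape from `v` to the far right, off
`Λ` as well.  Contradiction.

All statements folklore (boundary tracing of a polyomino; discrete winding numbers, Kesten, *Percolation theory for
mathematicians* (1982), §2.2, formalised in `PlanarDuality.lean` / `RandomClusterBoxDuality.lean` /
`SquareTilingConjugate.lean`); no literature fact is introduced; nothing restates the crux.
-/

noncomputable section

open SimpleGraph
open Literature.Probability.LatticeModels Literature.Probability.Percolation
open Literature.Probability.LatticeModels.SquareTiling (corners mem_corners_iff walkWinding_eq_of_walk_closed
  walkWinding_eq_of_mem_corners)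

namespace Summit.CriticalPhenomena.SAWScalingLimit.Theorems.FKGToTraversalBound.SlitNecklace

/-! ### Small bookkeeping -/

/-- A lattice step moves. [folklore] -/
private theorem straight_add_vec_ne_self (x : Site 2) (d : ODir) : x + d.vec ≠ x := by
  intro h
  have h0 := congrFun h 0
  have h1 := congrFun h 1
  fin_cases d <;> simp [ODir.vec] at h0 h1

/-- A lattice step and its opposite differ. [folklore] -/
private theorem straight_add_vec_ne_sub (x : Site 2) (d : ODir) : x + d.vec ≠ x - d.vec := by
  intro h
  have h0 := congrFun h 0
  have h1 := congrFun h 1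
  fin_cases d <;> simp [ODir.vec] at h0 h1 <;> omega

/-- The four directions, seen from `d`. [folklore] -/
private theorem straight_dir_cases (d e : ODir) : e = d ∨ e = d.ccw ∨ e = d.rev ∨ e = d.cw := by
  revert d e
  decide

/-- In a path from `a` to `b`, the edge `{a, b}` can only be the whole path. [folklore] -/
private theorem straight_length_eq_one {V : Type*} {G : SimpleGraph V} {a b : V} :
    ∀ {P : G.Walk a b}, P.IsPath → s(a, b) ∈ P.edges → P.length = 1
  | .nil, _, h => by simp at h
  | .cons (v := c) hadj P', hP, h => by
    rw [Walk.cons_isPath_iff] at hP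
    rw [Walk.edges_cons, List.mem_cons] at h
    rcases h with h | h
    · rcases Sym2.eq_iff.1 h with ⟨-, hbc⟩ | ⟨hac, -⟩
      · subst hbc
        rw [Walk.length_cons, Walk.length_eq_zero_iff.2 (Walk.isPath_iff_nil.1 hP.1)]
      · exact absurd (hac ▸ P'.start_mem_support) hP.2
    · exact absurd (P'.fst_mem_support_of_mem_edges h) hP.2

/-- **Sub-path of a path between two indices**, with its length and the indices of its vertices. [folklore] -/
private theorem straight_subpath {u v : Site 2} {r : (zdGraph 2).Walk u v} (hr : r.IsPath) {i j : ℕ}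
    (hij : i ≤ j) (hj : j ≤ r.length) {x y : Site 2} (hx : r.getVert i = x) (hy : r.getVert j = y) :
    ∃ P : (zdGraph 2).Walk x y, P.IsPath ∧ P.length = j - i ∧
      ∀ z ∈ P.support, ∃ k, i ≤ k ∧ k ≤ j ∧ r.getVert k = z := by
  subst hx
  have hy' : (r.drop i).getVert (j - i) = y := by rw [Walk.drop_getVert, Nat.add_sub_cancel' hij, hy]
  refine ⟨((r.drop i).take (j - i)).copy rfl hy', ?_, ?_, ?_⟩
  · rw [Walk.isPath_copy]
    exact (hr.drop i).take _
  · rw [Walk.length_copy, Walk.take_length, Walk.drop_length]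
    omega
  · intro z hz
    rw [Walk.support_copy] at hz
    obtain ⟨k, hk, -⟩ := Walk.mem_support_iff_exists_getVert.1 hz
    rw [Walk.take_getVert, Walk.drop_getVert] at hk
    exact ⟨i + min (j - i) k, by omega, by omega, hk⟩

/-! ### Faces of the closing edge of the pocket -/

/-- The start-corner face of `(x, ccw d)` is a face around `x + d` (the `+d` side of the edge `{x, x + ccw d}`).
[folklore] -/
private theorem straight_face_mem_corners_B (x : Site 2) (d : ODir) :
    cornerFace (x, d.ccw) + 1 ∈ corners (x + d.vec) := by
  rw [mem_corners_iff]
  fin_cases d <;> simp [ODir.foff, ODir.vec, ODir.ccw]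

/-- The other face of the edge `{f + d, f + d + ccw d}` (its `-d` side) is a face around `f`. [folklore] -/
private theorem straight_face_mem_corners_A (f : Site 2) (d : ODir) :
    cornerFace (f + d.vec, d.ccw) + d.ccw.ccw.vec + 1 ∈ corners f := by
  rw [mem_corners_iff]
  fin_cases d <;> simp [ODir.foff, ODir.vec, ODir.ccw]

/-- The face `q` is a face around the site `q`. [folklore] -/
private theorem straight_add_one_mem_corners (q : Site 2) : q + 1 ∈ corners q := by
  rw [mem_corners_iff]
  simp

/-- A closed walk winds equally about a face around a site off the walk and about the face named by that site.
[folklore] -/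
private theorem straight_walkWinding_face_eq {a : Site 2} (Λ : (zdGraph 2).Walk a a) {φ q : Site 2}
    (hq : q ∉ Λ.support) (hφ : φ + 1 ∈ corners q) : walkWinding Λ φ = walkWinding Λ q := by
  have h1 := walkWinding_eq_of_mem_corners Λ hq hφ
  have h2 := walkWinding_eq_of_mem_corners Λ hq (straight_add_one_mem_corners q)
  rw [add_sub_cancel_right] at h1 h2
  exact h1.trans h2.symm

/-! ### The pocket loop -/

/-- **The pocket contradiction.**  A lattice trail `P` from `f + d + ccw d` to `f + d` not using the edge
`{f + d, f + d + ccw d}`, closed up by that edge, is a closed trail `Λ`; if both the site `f + d + d` (a corner of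
the face of the closing edge on the `+d` side) and the site `f` (a corner of the face on the `-d` side) are joined
off `P` to sites to the right of `P`, then `Λ` winds `0` about both faces of an edge it uses once — impossible.
[folklore] -/
private theorem straight_pocket_core {f : Site 2} {d : ODir}
    (P : (zdGraph 2).Walk (f + d.vec + d.ccw.vec) (f + d.vec)) (hPn : P.edges.Nodup)
    (hPe : s(f + d.vec, f + d.vec + d.ccw.vec) ∉ P.edges) {R : ℤ} (hR : ∀ z ∈ P.support, z 0 ≤ R)
    {b₁ : Site 2} (πB : (zdGraph 2).Walk (f + d.vec + d.vec) b₁)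
    (hπB : ∀ z ∈ πB.support, z ∉ P.support) (hb₁ : R ≤ b₁ 0)
    {a₁ : Site 2} (πA : (zdGraph 2).Walk f a₁) (hπA : ∀ z ∈ πA.support, z ∉ P.support)
    (ha₁ : R ≤ a₁ 0) : False := by
  -- the closed trail
  have hΛs : ∀ z ∈ (Walk.cons (ODir.adj_add_vec (f + d.vec) d.ccw) P).support, z ∈ P.support := by
    intro z hz
    rw [Walk.support_cons, List.mem_cons] at hz
    rcases hz with rfl | hz
    · exact P.end_mem_support
    · exact hz
  have hΛn : (Walk.cons (ODir.adj_add_vec (f + d.vec) d.ccw) P).edges.Nodup := by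
    rw [Walk.edges_cons, List.nodup_cons]
    exact ⟨hPe, hPn⟩
  have hΛe : s(f + d.vec, f + d.vec + d.ccw.vec) ∈ (Walk.cons (ODir.adj_add_vec (f + d.vec) d.ccw) P).edges := by
    rw [Walk.edges_cons]
    exact List.mem_cons_self
  have hΛR : ∀ z ∈ (Walk.cons (ODir.adj_add_vec (f + d.vec) d.ccw) P).support, z 0 ≤ R :=
    fun z hz => hR z (hΛs z hz)
  -- the jump across the closing edge
  have hjump : walkWinding (Walk.cons (ODir.adj_add_vec (f + d.vec) d.ccw) P) (cornerFace (f + d.vec, d.ccw)) ≠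
      walkWinding (Walk.cons (ODir.adj_add_vec (f + d.vec) d.ccw) P)
        (cornerFace (f + d.vec, d.ccw) + d.ccw.ccw.vec) :=
    abab_walkWinding_ne_of_sepEdge_mem hΛn (ODir.adj_add_vec _ d.ccw.ccw) (by rw [sepEdge_cornerFace]; exact hΛe)
  -- the `+d` face reads `0`
  have hBq : f + d.vec + d.vec ∉ (Walk.cons (ODir.adj_add_vec (f + d.vec) d.ccw) P).support :=
    fun h => hπB _ πB.start_mem_support (hΛs _ h)
  have hB : walkWinding (Walk.cons (ODir.adj_add_vec (f + d.vec) d.ccw) P) (cornerFace (f + d.vec, d.ccw)) = 0 :=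
    (straight_walkWinding_face_eq _ hBq (straight_face_mem_corners_B (f + d.vec) d)).trans
      ((walkWinding_eq_of_walk_closed _ πB fun z hz h => hπB z hz (hΛs z h)).trans
        (Literature.Probability.LatticeModels.walkWinding_eq_zero_of_right hΛR hb₁))
  -- the `-d` face reads `0`
  have hAq : f ∉ (Walk.cons (ODir.adj_add_vec (f + d.vec) d.ccw) P).support :=
    fun h => hπA _ πA.start_mem_support (hΛs _ h)
  have hA : walkWinding (Walk.cons (ODir.adj_add_vec (f + d.vec) d.ccw) P)
      (cornerFace (f + d.vec, d.ccw) + d.ccw.ccw.vec) = 0 :=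
    (straight_walkWinding_face_eq _ hAq (straight_face_mem_corners_A f d)).trans
      ((walkWinding_eq_of_walk_closed _ πA fun z hz h => hπA z hz (hΛs z h)).trans
        (Literature.Probability.LatticeModels.walkWinding_eq_zero_of_right hΛR ha₁))
  exact hjump (hB.trans hA.symm)

/-! ### The registered stub -/

/-- **Registered stub (witness unit U5b): a STRAIGHT step of the wall-follower tour moves the obstacle contact
index forward.**  `A` is the free component, `r` the obstacle path (a far piece of the chord, all contacts of left
type), with escapes to the far right; at a boundary edge `(f, d)` with contact `r m = f + d` and `f + ccw d ∈ A`,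
the next contact `r m' = f + ccw d + d` has `m < m'` (a backward pinch would bound a pocket about which the pocket
loop winds both `0` and `±1`). [folklore] -/
theorem obstacle_step_straight : ∀ (A : Finset (Site 2)) {u v : Site 2} (r : (zdGraph 2).Walk u v) (Rbig : ℤ) (u₁ v₁ a₀ c₀ c₁ : Site 2) (εu : (zdGraph 2).Walk u u₁) (εv : (zdGraph 2).Walk v v₁) (εc : (zdGraph 2).Walk c₀ c₁) (f : Site 2) (d : ODir) (m m' : ℕ), r.IsPath → 2 ≤ r.length → (∀ x ∈ A, ∀ y ∈ A, ∃ w : (zdGraph 2).Walk x y, ∀ z ∈ w.support, z ∈ A) → (∀ z ∈ r.support, z ∉ A) → (∀ (f' : Site 2) (d' : ODir) (n : ℕ), f' ∈ A → 0 < n → n < r.length → r.getVert n = f' + d'.vec → (r.getVert (n + 1) = r.getVert n + d'.ccw.vec ∨ r.getVert (n - 1) = r.getVert n - d'.ccw.vec)) → (∀ z : Site 2, (z ∈ A ∨ z ∈ r.support) → z 0 + 2 ≤ Rbig) → Rbig ≤ u₁ 0 → Rbig ≤ v₁ 0 → Rbig ≤ c₁ 0 → (∀ z ∈ εu.support, z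 ∉ A ∧ ∀ n, 0 < n → n < r.length → z ≠ r.getVert n) → (∀ z ∈ εv.support, z ∉ A ∧ ∀ n, 0 < n → n < r.length → z ≠ r.getVert n) → a₀ ∈ A → c₀ ∉ A → (zdGraph 2).Adj a₀ c₀ → (∀ n, 0 < n → n < r.length → c₀ ≠ r.getVert n) → (∀ z ∈ εc.support, z ∉ A ∧ ∀ n, 0 < n → n < r.length → z ≠ r.getVert n) → f ∈ A → 0 < m → m < r.length → 0 < m' → m' < r.length → r.getVert m = f + d.vec → f + d.ccw.vec ∈ A → r.getVert m' = f + d.ccw.vec + d.vec → m < m' := by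
  intro A u v r Rbig u₁ v₁ a₀ c₀ c₁ εu εv εc f d m m' hr _hL hA hrA hleft hRbig _hu₁ hv₁ hc₁ _hεu hεv ha₀
    _hc₀ hac _hc₀r hεc hf hm0 hmL hm'0 hm'L hm hf' hm'
  by_contra hlt
  rw [not_lt] at hlt
  have hinj : ∀ i j, i ≤ r.length → j ≤ r.length → r.getVert i = r.getVert j → i = j :=
    fun i j hi hj h => hr.getVert_injOn hi hj h
  have hm'v : r.getVert m' = r.getVert m + d.ccw.vec := by rw [hm, hm', add_right_comm]
  -- (a) left type at the edge ahead `(f + t, d)`: its backward alternative is a forward step `m' = m + 1`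
  have hL1' : r.getVert (m' + 1) = r.getVert m' + d.ccw.vec := by
    refine (hleft _ d m' hf' hm'0 hm'L hm').resolve_right fun h => ?_
    rw [hm'v, add_sub_cancel_right] at h
    have := hinj (m' - 1) m (by omega) hmL.le h
    omega
  -- (b) left type at `(f, d)`: its forward alternative is a forward step as well
  have hL2 : r.getVert (m - 1) = r.getVert m - d.ccw.vec := by
    refine (hleft f d m hf hm0 hmL hm).resolve_left fun h => ?_
    rw [← hm'v] at h
    have := hinj (m + 1) m' (by omega) hm'L.le h
    omega
  -- so the two contacts form a pinch at index distance `≥ 2`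
  have h2 : m' + 2 ≤ m := by
    rcases Nat.lt_or_ge m (m' + 2) with h | h
    · exfalso
      rcases (show m' = m ∨ m' + 1 = m by omega) with rfl | h'
      · exact straight_add_vec_ne_self _ _ hm'v.symm
      · have h1 : r.getVert (m - 1) = r.getVert m' := by
          congr 1
          omega
        rw [hL2, hm'v] at h1
        exact straight_add_vec_ne_sub _ _ h1.symm
    · exact h
  -- the successor of `r m` is the free neighbour `r m + d`
  have hsucc : r.getVert (m + 1) = r.getVert m + d.vec := by
    obtain ⟨e, he⟩ := ODir.exists_eq_add_vec_of_adj (r.adj_getVert_succ hmL)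
    rcases straight_dir_cases d e with rfl | rfl | rfl | rfl
    · exact he
    · exfalso
      have := hinj (m + 1) m' (by omega) hm'L.le (he.trans hm'v.symm)
      omega
    · exfalso
      refine hrA _ (r.getVert_mem_support (m + 1)) ?_
      rw [he, hm, ODir.vec_rev, ← sub_eq_add_neg, add_sub_cancel_right]
      exact hf
    · exfalso
      rw [ODir.vec_cw, ← sub_eq_add_neg, ← hL2] at he
      have := hinj (m + 1) (m - 1) (by omega) (by omega) he
      omega
  -- the pocket: the sub-path of `r` from `m'` to `m`
  have hPs : r.getVert m' = f + d.vec + d.ccw.vec := by rw [hm'v, hm]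
  obtain ⟨P, hPpath, hPlen, hPsupp⟩ := straight_subpath hr hlt hmL.le hPs hm
  have hPint : ∀ z ∈ P.support, ∃ k, 0 < k ∧ k < r.length ∧ r.getVert k = z := fun z hz => by
    obtain ⟨k, hk1, hk2, hk⟩ := hPsupp z hz
    exact ⟨k, by omega, by omega, hk⟩
  have hPA : ∀ z ∈ P.support, z ∉ A := fun z hz => by
    obtain ⟨k, -, -, rfl⟩ := hPsupp z hz
    exact hrA _ (r.getVert_mem_support k)
  have hPR : ∀ z ∈ P.support, z 0 ≤ Rbig - 2 := fun z hz => by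
    obtain ⟨k, -, -, rfl⟩ := hPsupp z hz
    have := hRbig _ (Or.inr (r.getVert_mem_support k))
    omega
  -- the closing edge `{r m, r m + t}` is not an edge of the pocket path (it has length `≥ 2`)
  have hPedge : s(f + d.vec, f + d.vec + d.ccw.vec) ∉ P.edges := fun h => by
    have := straight_length_eq_one hPpath (by rwa [Sym2.eq_swap])
    omega
  -- the `+d` corner `r (m + 1)` escapes along the tail of `r` and `εv`
  have hB0 : r.getVert (m + 1) = f + d.vec + d.vec := by rw [hsucc, hm]
  have hπB : ∀ z ∈ (((r.drop (m + 1)).copy hB0 rfl).append εv).support, z ∉ P.support := by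
    intro z hz hzP
    rw [Walk.mem_support_append_iff, Walk.support_copy] at hz
    obtain ⟨k, hk1, hk2, hk⟩ := hPsupp z hzP
    rcases hz with hz | hz
    · obtain ⟨k', hk', hk'len⟩ := Walk.mem_support_iff_exists_getVert.1 hz
      rw [Walk.drop_getVert] at hk'
      rw [Walk.drop_length] at hk'len
      have := hinj k (m + 1 + k') (by omega) (by omega) (hk.trans hk'.symm)
      omega
    · exact (hεv z hz).2 k (by omega) (by omega) hk.symm
  -- the `-d` corner `f` escapes through `A`, the edge `{a₀, c₀}` and `εc`
  obtain ⟨α, hα⟩ := hA f hf a₀ ha₀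
  have hπA : ∀ z ∈ (α.append (Walk.cons hac εc)).support, z ∉ P.support := by
    intro z hz hzP
    rw [Walk.mem_support_append_iff, Walk.support_cons, List.mem_cons] at hz
    rcases hz with hz | rfl | hz
    · exact hPA z hzP (hα z hz)
    · exact hPA _ hzP ha₀
    · obtain ⟨k, hk1, hk2, hk⟩ := hPint _ hzP
      exact (hεc _ hz).2 k hk1 hk2 hk.symm
  exact straight_pocket_core P hPpath.edges_nodup hPedge hPR (((r.drop (m + 1)).copy hB0 rfl).append εv) hπB
    (by omega) (α.append (Walk.cons hac εc)) hπA (by omega)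

end Summit.CriticalPhenomena.SAWScalingLimit.Theorems.FKGToTraversalBound.SlitNecklace

end
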